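import Summits.BirchSwinnertonDyer.BirchSwinnertonDyer.Theorems.ResidualThetaTransportAtTwoResidualSignedLambdaLowerCMAtTwoLayerPairingOfFunNondegenerate
import Literature.NumberTheory.GaloisRepresentations.ContinuousShapiroLiftMackeyH1Equiv
import HarnessLib

/-!
# The S₀-sockets of the Mackey package in `SelmerComplement` currency, at EVERY finite place `v` (many orbits): the local Tate pairing
# (mod `N`, THE canonical invariant maps) of `loc_v(Sh a)` against a local dual class `H¹(Ψ_v) u` with PRESCRIBED components, and against
# `loc_v(H¹(Ψ)(Sh x))` — the many-orbit twins of `…CoindShapiroOfFun` §2 — plus `H¹(Ψ_v)` bijective and dual classes with prescribed components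

Route `ResidualThetaTransportAtTwo` (RTT), crux RSL_g `ResidualSignedLambdaLowerCMAtTwo` (stmt-BirchSwinnertonDyer-22608); seat
`prover-bsd-wall-tp2-p2x` g17 (`--supports 22608 --as helper`, closes nothing). THEOREMS ONLY (no definition, no named fact, no instance,
no `sorry`). These are the CONCRETE instances of the hypotheses `hsplit` / `hR1` / `hπd`-side data of the abstract package glue
`MackeyPackage.levelwise_exists_of_mackeyPackage` (`…MackeyPackageGlue.lean`) for `Maps(Γ_ℚ ⧸ Γ_n, M)` at a place `v ∈ S₀` (STUB-PLAN rev 18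
items 7/8, S66 (3)(6)): with orbit representatives `g : ι → Γ_ℚ` (`exists_orbitReps_bijective`), `Ψ = coindTateDualMor` for a non-degenerate
`e : M × M → μ_N`, `Sh` = global Shapiro lift, `loc_v = galoisCohomology.localization`:

* §1 `localization_eq_map` (`loc_v` on `H^q(ℚ, Maps)` IS `ContinuousCohomology.map θ_v (𝟙 _)`, `rfl`), **`localTatePairingZMod_canonical_localization_shapiroLift_eq_sum`**:
  `⟨loc_v(Sh a), H¹(Ψ_v) u⟩_v = Σ_i layerPairingOf (g_i · a) (b i)` whenever `H¹(Φ_{g_iΓ_n}) u = Sh(b i)` (= `hsplit`);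
* §2 **`localTatePairingZMod_canonical_localization_shapiroLift_shapiroLift_eq_sum`** (both factors global):
  `⟨loc_v(Sh a), loc_v(H¹(Ψ)(Sh x))⟩_v = Σ_i layerPairingOf (g_i · a) (loc_n(g_i · x))` — the many-orbit twin of
  `CoindShapiroOfFun.localTatePairingZMod_canonical_localization_shapiroLift_shapiroLift` (there one orbit at `v ∣ p`);
* §3 `bijective_cohomologyMap_coindTateDual_res` (`H¹(Γ_v, Ψ)` is bijective for `e` non-degenerate, `N • M = 0`) and
  `exists_localDual_forall_component_eq` (a local DUAL class `y = H¹(Ψ_v) u ∈ H¹(ℚ_v, Maps^D)` with PRESCRIBED layer components `t i` — `hR1` on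
  the dual side).

References: [MilneADT2006] I Cor. 2.3, I §6 (proof of Prop. 6.9), I Thm. 4.10; [NeukirchSchmidtWingberg2008] I §5 (1.5.3)(iv), (1.5.6)–(1.5.7), I §6
(1.6.4)–(1.6.5); [Brown1982] III §5 (5.6)(b); [Kobayashi2003] (8.23). BSD is not proved by any of this; RSL_g is not proved here.
-/

set_option autoImplicit false
-- the Theorems namespace of this sub repeats the summit name by design (D-0017 nested layout)
set_option linter.dupNamespace false

noncomputable section

open scoped Classical

namespace Summit.BirchSwinnertonDyer.BirchSwinnertonDyer.Theorems

namespace ThetaTransport.LayerPairingMackeyDual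

open CategoryTheory Function Field NumberField IsDedekindDomain
  Literature.NumberTheory.EllipticCurves Literature.NumberTheory.EllipticCurves.CyclotomicLayer
  Literature.NumberTheory.GaloisRepresentations Literature.NumberTheory.GaloisRepresentations.DiscreteGaloisModule
  Literature.NumberTheory.GaloisCohomology ZpExtension
open SignedLowerOffTwo.PTDeep (bijective_cohomologyMap_of_bijective)
open LayerPairingNondegenerate (localTatePairing_coind_cohomologyMap_eq_cupProduct_restrict)

variable {M : Type} [AddCommGroup M] [TopologicalSpace M] [DiscreteTopology M] [Finite M]
  (ρM : DiscreteGaloisModule ℚ M) (N : ℕ) [NeZero N]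
  (e : M → M → AlgebraicClosure ℚ)
  (hμ : ∀ S T, e S T ^ N = 1)
  (hadd₁ : ∀ S₁ S₂ T, e (S₁ + S₂) T = e S₁ T * e S₂ T)
  (hadd₂ : ∀ S T₁ T₂, e S (T₁ + T₂) = e S T₁ * e S T₂)
  (hgal : ∀ (σ : absoluteGaloisGroup ℚ) (S T : M), σ • e S T = e (ρM σ S) (ρM σ T))
  {p : ℕ} [Fact p.Prime] (κ : ZpExtension ℚ p) (v : HeightOneSpectrum (𝓞 ℚ)) (n : ℕ)

/-! ## §1 `loc_v(Sh a)` against a local dual class with prescribed components -/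

omit [Finite M] in
/-- `loc_v` on `H^q(ℚ, X)` for a discrete module is `ContinuousCohomology.map θ_v (𝟙 X|_{θ_v})` (definitional; `θ_v = resGalOfEmb (closureEmb ℚ_v)`
is the tree's `absGaloisRestrict ℚ ℚ_v`). [cite: NeukirchSchmidtWingberg2008, I §5 (1.5.2)] -/
theorem localization_eq_map {X : Type} [AddCommGroup X] [TopologicalSpace X] [DiscreteTopology X] (ρ : DiscreteGaloisModule ℚ X) (q : ℕ)
    (z : galoisCohomology ρ q) :
    galoisCohomology.localization ρ (Sum.inr v) q z =
      ContinuousCohomology.map (resGalOfEmb (closureEmb (K := ℚ) (v.adicCompletion ℚ)))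
        (𝟙 (TopRep.res (resGalOfEmb (closureEmb (K := ℚ) (v.adicCompletion ℚ)) :
          absoluteGaloisGroup (v.adicCompletion ℚ) →* absoluteGaloisGroup ℚ) ρ.toTopRep)) q z :=
  rfl

/-- **`hsplit` at `v ∈ S₀`: `⟨loc_v(Sh a), H¹(Ψ_v) u⟩_v = Σ_i ⟨g_i · a, b_i⟩_{n,N,v}`.** For orbit representatives `g` (`hbij`), a layer class
`a ∈ H¹(Γ_n, M)`, a LOCAL class `u ∈ H¹(Γ_v, Maps(Γ_ℚ ⧸ Γ_n, M)|_θ)` with components `H¹(Φ_{g_iΓ_n}) u = Sh(b_i)`: the local Tate pairing modulo `N`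
for THE canonical invariant maps of `loc_v(Sh a)` with `H¹(Γ_v, Ψ) u` is `Σ_i layerPairingOf … (g_i · a) (b i)` (§1 of `…LayerPairingOfFunNondegenerate`
+ `CyclotomicLayer.invAt_cupProduct_map_shapiroLift_eq_sum`). [cite: NeukirchSchmidtWingberg2008, I §5 Prop. (1.5.3) (iv), I §6 Prop. (1.6.5)]
[cite: MilneADT2006, Ch. I §6 (proof of Prop. 6.9)] [cite: Kobayashi2003, (8.23) (p. 18)] -/
theorem localTatePairingZMod_canonical_localization_shapiroLift_eq_sum [CompactSpace (absoluteGaloisGroup ℚ)]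
    [CompactSpace (absoluteGaloisGroup (v.adicCompletion ℚ))] [Fintype (absoluteGaloisGroup ℚ ⧸ κ.layerSubgroup n)]
    {s : absoluteGaloisGroup ℚ ⧸ κ.layerSubgroup n → absoluteGaloisGroup ℚ}
    (hs : ∀ y, (s y : absoluteGaloisGroup ℚ ⧸ κ.layerSubgroup n) = y)
    (hs1 : s ((1 : absoluteGaloisGroup ℚ) : absoluteGaloisGroup ℚ ⧸ κ.layerSubgroup n) = 1)
    {ι : Type} [Fintype ι] (g : ι → absoluteGaloisGroup ℚ)
    (hbij : Function.Bijective fun q : ι × (absoluteGaloisGroup (v.adicCompletion ℚ) ⧸ layerGroup κ v n) =>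
      quotientMapOfHom (κ.layerSubgroup n) (resGalOfEmb (closureEmb (K := ℚ) (v.adicCompletion ℚ))) q.2 *
        (g q.1 : absoluteGaloisGroup ℚ ⧸ κ.layerSubgroup n))
    (a : H1 ρM (κ.layerSubgroup n))
    (u : continuousCohomology 1 (TopRep.res (resGalOfEmb (closureEmb (K := ℚ) (v.adicCompletion ℚ)) :
      absoluteGaloisGroup (v.adicCompletion ℚ) →* absoluteGaloisGroup ℚ) (coindFin ρM.toTopRep (κ.layerSubgroup n))))
    (b : ι → continuousCohomology 1 (subgroupRep (localRepOf ρM v) (layerGroup κ v n)))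
    (hb : ∀ i, cohomologyMap (resCoindFinHomR ρM.toTopRep (κ.layerSubgroup n) (resGalOfEmb (closureEmb (K := ℚ) (v.adicCompletion ℚ)))
        (g i : absoluteGaloisGroup ℚ ⧸ κ.layerSubgroup n)) 1 u = layerShapiroOf ρM κ v n (b i)) :
    localTatePairingZMod (ρM.coind (κ.layerSubgroup n) (κ.isOpen_layerSubgroup n)) N (Sum.inr v)
        (LocalInvariants.canonical ℚ N (Sum.inr v))
        (galoisCohomology.localization (ρM.coind (κ.layerSubgroup n) (κ.isOpen_layerSubgroup n)) (Sum.inr v) 1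
          (shapiroLift ρM.toTopRep (κ.layerSubgroup n) (κ.isOpen_layerSubgroup n) hs hs1 a))
        (cohomologyMap (TopRep.ofHom ⟨(coindTateDualMor ρM ρM (κ.layerSubgroup n) (pairingHomOfFun N e hμ hadd₁ hadd₂)
            (κ.isOpen_layerSubgroup n) (fun σ S T => (contPairingOfFun ρM N e hμ hadd₁ hadd₂ hgal).toLin_smul σ S T)).hom.toContinuousLinearMap,
            fun d => (coindTateDualMor ρM ρM (κ.layerSubgroup n) (pairingHomOfFun N e hμ hadd₁ hadd₂) (κ.isOpen_layerSubgroup n)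
              (fun σ S T => (contPairingOfFun ρM N e hμ hadd₁ hadd₂ hgal).toLin_smul σ S T)).hom.isIntertwining'
                (absGaloisRestrict ℚ (Place.Completion (Sum.inr v : Place ℚ)) d)⟩ :
          TopRep.res (absGaloisRestrict ℚ (Place.Completion (Sum.inr v : Place ℚ)) :
              absoluteGaloisGroup (Place.Completion (Sum.inr v : Place ℚ)) →* absoluteGaloisGroup ℚ)
              (coindFin.{0, 0} ρM.toTopRep (κ.layerSubgroup n)) ⟶
            (((ρM.coind (κ.layerSubgroup n) (κ.isOpen_layerSubgroup n)).tateDual N).toLocal (Sum.inr v)).toTopRep) 1 u) =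
      ∑ i, layerPairingOf ρM N e hμ hadd₁ hadd₂ hgal κ v n (conjMap ρM.toTopRep (κ.layerSubgroup n) (g i) 1 a) (b i) := by
  haveI : CompactSpace (absoluteGaloisGroup (Place.Completion (Sum.inr v : Place ℚ))) :=
    ‹CompactSpace (absoluteGaloisGroup (v.adicCompletion ℚ))›
  rw [localTatePairingZMod_apply]
  have key := localTatePairing_coind_cohomologyMap_eq_cupProduct_restrict ρM ρM (κ.layerSubgroup n)
    (pairingHomOfFun N e hμ hadd₁ hadd₂) (κ.isOpen_layerSubgroup n)
    (fun σ S T => (contPairingOfFun ρM N e hμ hadd₁ hadd₂ hgal).toLin_smul σ S T) (Sum.inr v)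
    (galoisCohomology.localization (ρM.coind (κ.layerSubgroup n) (κ.isOpen_layerSubgroup n)) (Sum.inr v) 1
      (shapiroLift ρM.toTopRep (κ.layerSubgroup n) (κ.isOpen_layerSubgroup n) hs hs1 a)) u
  rw [key]
  -- the restricted summed cup product, re-read with `θ_v = resGalOfEmb (closureEmb ℚ_v)`, `contPairingOfFun` and `loc_v = θ_v^*` (definitional)
  have hloc : galoisCohomology.localization (ρM.coind (κ.layerSubgroup n) (κ.isOpen_layerSubgroup n)) (Sum.inr v) 1
        (shapiroLift ρM.toTopRep (κ.layerSubgroup n) (κ.isOpen_layerSubgroup n) hs hs1 a) =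
      ContinuousCohomology.map (resGalOfEmb (closureEmb (K := ℚ) (v.adicCompletion ℚ)))
        (𝟙 (TopRep.res (resGalOfEmb (closureEmb (K := ℚ) (v.adicCompletion ℚ)) :
          absoluteGaloisGroup (v.adicCompletion ℚ) →* absoluteGaloisGroup ℚ) (coindFin ρM.toTopRep (κ.layerSubgroup n)))) 1
        (shapiroLift ρM.toTopRep (κ.layerSubgroup n) (κ.isOpen_layerSubgroup n) hs hs1 a) :=
    localization_eq_map v _ 1 _
  have hcup : (((pairing ρM ρM (mu ℚ N) (pairingHomOfFun N e hμ hadd₁ hadd₂)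
        (fun σ S T => (contPairingOfFun ρM N e hμ hadd₁ hadd₂ hgal).toLin_smul σ S T)).coindFin (κ.layerSubgroup n)).restrict
        (absGaloisRestrict ℚ (Place.Completion (Sum.inr v : Place ℚ)))).cupProduct
        (galoisCohomology.localization (ρM.coind (κ.layerSubgroup n) (κ.isOpen_layerSubgroup n)) (Sum.inr v) 1
          (shapiroLift ρM.toTopRep (κ.layerSubgroup n) (κ.isOpen_layerSubgroup n) hs hs1 a)) u =
      (((contPairingOfFun ρM N e hμ hadd₁ hadd₂ hgal).coindFin (κ.layerSubgroup n)).restrict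
          (resGalOfEmb (closureEmb (K := ℚ) (v.adicCompletion ℚ)))).cupProduct
        (ContinuousCohomology.map (resGalOfEmb (closureEmb (K := ℚ) (v.adicCompletion ℚ)))
          (𝟙 (TopRep.res (resGalOfEmb (closureEmb (K := ℚ) (v.adicCompletion ℚ)) :
            absoluteGaloisGroup (v.adicCompletion ℚ) →* absoluteGaloisGroup ℚ) (coindFin ρM.toTopRep (κ.layerSubgroup n)))) 1
          (shapiroLift ρM.toTopRep (κ.layerSubgroup n) (κ.isOpen_layerSubgroup n) hs hs1 a)) u := by
    rw [hloc]
    rfl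
  have h := invAt_cupProduct_map_shapiroLift_eq_sum ρM N e hμ hadd₁ hadd₂ hgal κ v n hs hs1 g hbij a u b hb
  exact (congrArg (invAt N v) hcup).trans (h.trans (Finset.sum_congr rfl fun i _ =>
    (layerPairingOf_apply ρM N e hμ hadd₁ hadd₂ hgal κ v n _ (b i)).symm))

/-! ## §2 Both factors global: `⟨loc_v(Sh a), loc_v(H¹(Ψ)(Sh x))⟩_v = Σ_i ⟨g_i · a, loc_n(g_i · x)⟩_{n,N,v}` -/

omit [Finite M] [NeZero N] in
/-- The Mackey component of the restriction of a global Shapiro lift, in LAYER currency: `H¹(Φ_{g_iΓ_n})(θ_v^*(Sh x)) = Sh^{Γ_v}(loc_n(g_i · x))`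
(`cohomologyMap_resCoindFinHomR_map_id` + `map_resCoindFinHomR_shapiroLift`). [cite: NeukirchSchmidtWingberg2008, I §5 (1.5.6)–(1.5.7), I §6 Prop. (1.6.4)] -/
theorem cohomologyMap_resCoindFinHomR_localization_shapiroLift [Fintype (absoluteGaloisGroup ℚ ⧸ κ.layerSubgroup n)]
    {s : absoluteGaloisGroup ℚ ⧸ κ.layerSubgroup n → absoluteGaloisGroup ℚ}
    (hs : ∀ y, (s y : absoluteGaloisGroup ℚ ⧸ κ.layerSubgroup n) = y)
    (hs1 : s ((1 : absoluteGaloisGroup ℚ) : absoluteGaloisGroup ℚ ⧸ κ.layerSubgroup n) = 1) (γ : absoluteGaloisGroup ℚ)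
    (x : H1 ρM (κ.layerSubgroup n)) :
    cohomologyMap (resCoindFinHomR ρM.toTopRep (κ.layerSubgroup n) (resGalOfEmb (closureEmb (K := ℚ) (v.adicCompletion ℚ)))
        (γ : absoluteGaloisGroup ℚ ⧸ κ.layerSubgroup n)) 1
        (galoisCohomology.localization (ρM.coind (κ.layerSubgroup n) (κ.isOpen_layerSubgroup n)) (Sum.inr v) 1
          (shapiroLift ρM.toTopRep (κ.layerSubgroup n) (κ.isOpen_layerSubgroup n) hs hs1 x)) =
      layerShapiroOf ρM κ v n (layerLocOf ρM κ v n (conjMap ρM.toTopRep (κ.layerSubgroup n) γ 1 x)) :=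
  (cohomologyMap_resCoindFinHomR_map_id ρM.toTopRep (κ.layerSubgroup n) (resGalOfEmb (closureEmb (K := ℚ) (v.adicCompletion ℚ)))
      (fun y : absoluteGaloisGroup ℚ ⧸ κ.layerSubgroup n => y) _ (γ : absoluteGaloisGroup ℚ ⧸ κ.layerSubgroup n)).trans
    (map_resCoindFinHomR_shapiroLift ρM.toTopRep (κ.layerSubgroup n) (resGalOfEmb (closureEmb (K := ℚ) (v.adicCompletion ℚ)))
      (κ.isOpen_layerSubgroup n) hs hs1 (layerReps_spec κ v n) (layerReps_one κ v n) γ x)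

/-- **The many-orbit twin of `CoindShapiroOfFun.localTatePairingZMod_canonical_localization_shapiroLift_shapiroLift`** (every finite `v`):
for layer classes `a, x ∈ H¹(Γ_n, M)`, the local Tate pairing modulo `N` (canonical invariant maps) of `loc_v(Sh a)` with `loc_v(H¹(Ψ)(Sh x))` is
the ORBIT SUM `Σ_i layerPairingOf … (g_i · a) (loc_n(g_i · x))` of the layer pairings at the places of `ℚ_n` above `v`
(`localization_cohomologyMap_coindTateDualMor` + §1 with `u = θ_v^*(Sh x)`, `b_i = loc_n(g_i · x)`). This is the local term at `v ∈ S₀` of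
Poitou–Tate for `Maps(Γ_ℚ ⧸ Γ_n, M)` in the currency `SelmerComplement` speaks. [cite: MilneADT2006, Ch. I §6 (proof of Prop. 6.9), Ch. I Thm. 4.10]
[cite: NeukirchSchmidtWingberg2008, I §5 Prop. (1.5.3) (iv), (1.5.6)–(1.5.7), I §6 (1.6.5)] [cite: Kobayashi2003, (8.23) (p. 18)] -/
theorem localTatePairingZMod_canonical_localization_shapiroLift_shapiroLift_eq_sum [CompactSpace (absoluteGaloisGroup ℚ)]
    [CompactSpace (absoluteGaloisGroup (v.adicCompletion ℚ))] [Fintype (absoluteGaloisGroup ℚ ⧸ κ.layerSubgroup n)]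
    {s : absoluteGaloisGroup ℚ ⧸ κ.layerSubgroup n → absoluteGaloisGroup ℚ}
    (hs : ∀ y, (s y : absoluteGaloisGroup ℚ ⧸ κ.layerSubgroup n) = y)
    (hs1 : s ((1 : absoluteGaloisGroup ℚ) : absoluteGaloisGroup ℚ ⧸ κ.layerSubgroup n) = 1)
    {ι : Type} [Fintype ι] (g : ι → absoluteGaloisGroup ℚ)
    (hbij : Function.Bijective fun q : ι × (absoluteGaloisGroup (v.adicCompletion ℚ) ⧸ layerGroup κ v n) =>
      quotientMapOfHom (κ.layerSubgroup n) (resGalOfEmb (closureEmb (K := ℚ) (v.adicCompletion ℚ))) q.2 *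
        (g q.1 : absoluteGaloisGroup ℚ ⧸ κ.layerSubgroup n))
    (a x : H1 ρM (κ.layerSubgroup n)) :
    localTatePairingZMod (ρM.coind (κ.layerSubgroup n) (κ.isOpen_layerSubgroup n)) N (Sum.inr v)
        (LocalInvariants.canonical ℚ N (Sum.inr v))
        (galoisCohomology.localization (ρM.coind (κ.layerSubgroup n) (κ.isOpen_layerSubgroup n)) (Sum.inr v) 1
          (shapiroLift ρM.toTopRep (κ.layerSubgroup n) (κ.isOpen_layerSubgroup n) hs hs1 a))
        (galoisCohomology.localization ((ρM.coind (κ.layerSubgroup n) (κ.isOpen_layerSubgroup n)).tateDual N) (Sum.inr v) 1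
          (cohomologyMap (coindTateDualMor ρM ρM (κ.layerSubgroup n) (pairingHomOfFun N e hμ hadd₁ hadd₂) (κ.isOpen_layerSubgroup n)
              (fun σ S T => (contPairingOfFun ρM N e hμ hadd₁ hadd₂ hgal).toLin_smul σ S T)) 1
            (shapiroLift ρM.toTopRep (κ.layerSubgroup n) (κ.isOpen_layerSubgroup n) hs hs1 x))) =
      ∑ i, layerPairingOf ρM N e hμ hadd₁ hadd₂ hgal κ v n (conjMap ρM.toTopRep (κ.layerSubgroup n) (g i) 1 a)
        (layerLocOf ρM κ v n (conjMap ρM.toTopRep (κ.layerSubgroup n) (g i) 1 x)) := by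
  rw [localization_cohomologyMap_coindTateDualMor]
  exact localTatePairingZMod_canonical_localization_shapiroLift_eq_sum ρM N e hμ hadd₁ hadd₂ hgal κ v n hs hs1 g hbij a _
    (fun i => layerLocOf ρM κ v n (conjMap ρM.toTopRep (κ.layerSubgroup n) (g i) 1 x))
    (fun i => cohomologyMap_resCoindFinHomR_localization_shapiroLift ρM κ v n hs hs1 (g i) x)

/-! ## §3 `H¹(Γ_v, Ψ)` is bijective; local dual classes with prescribed components -/

/-- **`H¹(Γ_v, Ψ) : H¹(Γ_v, Maps(Γ_ℚ ⧸ Γ_n, M)|_θ) → H¹(ℚ_v, Maps(Γ_ℚ ⧸ Γ_n, M)^D)` is BIJECTIVE** at every finite `v`, for `e` non-degenerate and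
`N • M = 0` (`Ψ` is an isomorphism of discrete modules: `coindTateDualHom_bijective` + `bijective_pairingHomOfFun_flip`; then
`bijective_cohomologyMap_of_bijective`). [cite: NeukirchSchmidtWingberg2008, I §6 Prop. (1.6.4)] [cite: MilneADT2006, Ch. I Cor. 2.3] -/
theorem bijective_cohomologyMap_coindTateDual_res [Fintype (absoluteGaloisGroup ℚ ⧸ κ.layerSubgroup n)]
    (hnondeg : ∀ T, (∀ S, e S T = 1) → T = 0) (hN : ∀ m : M, N • m = 0) :
    Function.Bijective (cohomologyMap (TopRep.ofHom ⟨(coindTateDualMor ρM ρM (κ.layerSubgroup n) (pairingHomOfFun N e hμ hadd₁ hadd₂)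
        (κ.isOpen_layerSubgroup n) (fun σ S T => (contPairingOfFun ρM N e hμ hadd₁ hadd₂ hgal).toLin_smul σ S T)).hom.toContinuousLinearMap,
        fun d => (coindTateDualMor ρM ρM (κ.layerSubgroup n) (pairingHomOfFun N e hμ hadd₁ hadd₂) (κ.isOpen_layerSubgroup n)
          (fun σ S T => (contPairingOfFun ρM N e hμ hadd₁ hadd₂ hgal).toLin_smul σ S T)).hom.isIntertwining'
            (absGaloisRestrict ℚ (Place.Completion (Sum.inr v : Place ℚ)) d)⟩ :
      TopRep.res (absGaloisRestrict ℚ (Place.Completion (Sum.inr v : Place ℚ)) :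
          absoluteGaloisGroup (Place.Completion (Sum.inr v : Place ℚ)) →* absoluteGaloisGroup ℚ)
          (coindFin.{0, 0} ρM.toTopRep (κ.layerSubgroup n)) ⟶
        (((ρM.coind (κ.layerSubgroup n) (κ.isOpen_layerSubgroup n)).tateDual N).toLocal (Sum.inr v)).toTopRep) 1) := by
  haveI : DiscreteTopology (TopRep.res (absGaloisRestrict ℚ (Place.Completion (Sum.inr v : Place ℚ)) :
      absoluteGaloisGroup (Place.Completion (Sum.inr v : Place ℚ)) →* absoluteGaloisGroup ℚ)
        (coindFin.{0, 0} ρM.toTopRep (κ.layerSubgroup n))) :=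
    inferInstanceAs (DiscreteTopology (absoluteGaloisGroup ℚ ⧸ κ.layerSubgroup n → M))
  haveI : DiscreteTopology ((((ρM.coind (κ.layerSubgroup n) (κ.isOpen_layerSubgroup n)).tateDual N).toLocal
      (Sum.inr v)).toTopRep) :=
    inferInstanceAs (DiscreteTopology (TateDual ℚ (absoluteGaloisGroup ℚ ⧸ κ.layerSubgroup n → M) N))
  exact bijective_cohomologyMap_of_bijective _ (coindTateDualHom_bijective (κ.layerSubgroup n) (pairingHomOfFun N e hμ hadd₁ hadd₂)
    (CoindShapiroOfFun.bijective_pairingHomOfFun_flip N e hμ hadd₁ hadd₂ hnondeg hN)) 1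

omit [Finite M] [NeZero N] in
/-- **Local DUAL classes with PRESCRIBED layer components** (`hR1` on the dual side): for every family `t : ι → H¹(U_n, M|)` there is a local class
`u ∈ H¹(Γ_v, Maps(Γ_ℚ ⧸ Γ_n, M)|_θ)` with `H¹(Φ_{g_iΓ_n}) u = Sh(t i)` for all `i` — hence the local dual class `y := H¹(Γ_v, Ψ) u ∈ H¹(ℚ_v, Maps^D)`
(unique by `bijective_cohomologyMap_coindTateDual_res`) whose pairing against every `loc_v(Sh a)` is `Σ_i ⟨g_i · a, t_i⟩` (§1). H¹-Mackey joint
surjectivity `exists_cohomologyMap_resCoindFinHomR_eq_shapiroLift`. [cite: Brown1982, III §5 (5.6)(b)] [cite: NeukirchSchmidtWingberg2008, I §6 Prop. (1.6.4)] -/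
theorem exists_local_forall_component_eq {ι : Type} (g : ι → absoluteGaloisGroup ℚ)
    (hbij : Function.Bijective fun q : ι × (absoluteGaloisGroup (v.adicCompletion ℚ) ⧸ layerGroup κ v n) =>
      quotientMapOfHom (κ.layerSubgroup n) (resGalOfEmb (closureEmb (K := ℚ) (v.adicCompletion ℚ))) q.2 *
        (g q.1 : absoluteGaloisGroup ℚ ⧸ κ.layerSubgroup n))
    (t : ι → continuousCohomology 1 (subgroupRep (localRepOf ρM v) (layerGroup κ v n))) :
    ∃ u : continuousCohomology 1 (TopRep.res (resGalOfEmb (closureEmb (K := ℚ) (v.adicCompletion ℚ)) :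
        absoluteGaloisGroup (v.adicCompletion ℚ) →* absoluteGaloisGroup ℚ) (coindFin ρM.toTopRep (κ.layerSubgroup n))),
      ∀ i, cohomologyMap (resCoindFinHomR ρM.toTopRep (κ.layerSubgroup n) (resGalOfEmb (closureEmb (K := ℚ) (v.adicCompletion ℚ)))
        (g i : absoluteGaloisGroup ℚ ⧸ κ.layerSubgroup n)) 1 u = layerShapiroOf ρM κ v n (t i) :=
  exists_cohomologyMap_resCoindFinHomR_eq_shapiroLift ρM.toTopRep (κ.layerSubgroup n)
    (resGalOfEmb (closureEmb (K := ℚ) (v.adicCompletion ℚ))) (κ.isOpen_layerSubgroup n) g hbij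
    (layerReps_spec κ v n) (layerReps_one κ v n) t

end ThetaTransport.LayerPairingMackeyDual

end Summit.BirchSwinnertonDyer.BirchSwinnertonDyer.Theorems

end
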